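/-
COR-CM (cell pub-hodgecm2, stage 2 of the Hodge ladder) — count-neutral KERNEL COMBINATORICS «field level of the SHEARED DIHEDRAL family: at least β(F) − 2
generating faces» (seat prover-pub-hodgecm2-b23-g52-0, binder prover b23, gen 52; own census lane, claim HOME/INBOX.md l.23708, blanket top-level
`CorCM/FaceShearedDihedral*` l.23712).  Theorems only; `Census/ShearedDihedral{Datum,Floor,BlockCount}.lean` (this seat), the field transfer
`CorCM/FaceGenerationTransfer.lean` and seat b09ʼs coinvariant floor are used BY NAME; nothing asserted.  `Interfaces.lean` (C1), every E term, B01,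
`Transposition/*`, `PortJoin/*`, `D2Bridge/*` untouched.
HONEST FRAMING: `HC_CM` is NOT proved, here or anywhere in the tree; this file produces no period and proves no face period for any field; it states a
LOWER bound only (the conjectured sheared dihedral law — equality — is open).
T5: n/a-class (hypothesis binders: a `ShearedDihedral.Datum (GalT F) conjT n` — inhabited by the Galois translates of any Galois CM field with group
`G_n` and complex conjugation `gⁿ` (Pauli-group fields for `n = 2`, `X_p`-fields for `n = p`) —, resp. three automorphisms with the six relations and
`[F:ℚ] = 8n`; checker: self, 2026-08-25).
-/
import Summits.HodgeConjecture.CorCM.Census.ShearedDihedralBlockCount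
import Summits.HodgeConjecture.CorCM.FaceGenerationTransfer
import Summits.HodgeConjecture.CorCM.FaceCensusOddSliceTransport
import HarnessLib

/-!
# Galois CM fields with group `G_n = ⟨g, s, x | g²ⁿ = s² = x² = 1, gs = sg, xgx = g⁻¹, xsx = gⁿs⟩` (conjugation `gⁿ`): at least `β(F) − 2` faces

Let `F` be a Galois CM field whose Galois translates carry a SHEARED DIHEDRAL DATUM (`Census/ShearedDihedralDatum.lean`) at level `n`: `Gal(F/ℚ) ≅ G_n` of
order `8n` with complex conjugation `c = gⁿ ∈ [Gal, Gal]` — the Pauli group `D₄ ∘ ℤ/4` (`n = 2`, degree 16), `X_p = ℤ/p ⋊ D₄` with Klein kernel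
(`n = p` odd, degree `8p`), `(ℤ/8 × ℤ/2) ⋊ (−a+4b, b)` (`n = 4`, degree 32), … .  None of the treeʼs face-generation laws covers these groups (`𝒦 = Gal`,
`c` a commutator; gen 51ʼs order-`8p` census left exactly `X_p` and `SL(2,3)` open).
* §1 **`card_block_sub_two_le_card_of_hgen`**: every finite face set `𝒮` satisfying INT2-GENʼs generation binder `hgen(𝒮, σ₀)` has **`β(F) − 2 ≤ |𝒮|`**
  (`= φ₂(F)`; part IIʼs floor carried to the field by `FaceTransfer.le_card_of_hgen_of_floor`); rows: degree 16 (`n = 2`) at least `20`, degree 24 (`n = 3`,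
  `X₃`) at least `192`, degree 32 (`n = 4`) at least `2126` faces (part IIIʼs block counts `β = 22, 194, 2128`).  The conjectured SHEARED DIHEDRAL LAW
  (`HOME/pub-hodgecm2-b23/SHEARED-DIHEDRAL.md`) is equality; numerically `μ = 20, 192, 2126`.
* §2 **the datum from the automorphism group** (`exists_datum_of_aut`; the degree is `8n` by `Datum.card_eq_eight_mul` and `FaceCensus.card_galT`).
No §3: the CONDITIONAL Hodge-conjecture reading waits for the law (a generating family of `β − 2` faces).

## References
* [Pohlmann1968] H. Pohlmann, Algebraic cycles on abelian varieties of complex multiplication type, Ann. of Math. 88 (1968), Thm 1.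
* [Milne1999] J. S. Milne, Lefschetz motives and the Tate conjecture, Compositio Math. 117 (1999), Prop. 2.1, p. 54.
-/

noncomputable section

open CategoryTheory NumberField NumberField.ComplexEmbedding
open Literature.AlgebraicGeometry Literature.AlgebraicGeometry.Motives Literature.AlgebraicGeometry.HodgeTheory
open Literature.AlgebraicGeometry.ComplexMultiplication Literature.AlgebraicGeometry.Milne1999
open Summit.HodgeConjecture.CorCM.Domination

namespace Summit.HodgeConjecture.CorCM.FaceShearedDihedral

open Summit.HodgeConjecture.CorCM.Prior.AllgGroup.RfwfAllgGroup
open Summit.HodgeConjecture.CorCM.Census.BlockParity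
open Summit.HodgeConjecture.CorCM.Census.Coinvariant
open Summit.HodgeConjecture.CorCM.Census
open Summit.HodgeConjecture.CorCM.FaceCensus.OddSlice (galTOfAut galTOfAut_mul galTOfAut_conjAut)

section Field

variable {F : Type} [Field F] [NumberField F] {n : ℕ}

/-! ## §1 At least `β(F) − 2 = φ₂(F)` generating faces -/

/-- **EVERY GALOIS CM FIELD WITH GROUP `G_n` (conjugation `gⁿ`) NEEDS AT LEAST `β(F) − 2` GENERATING FACES**: every finite face set with INT2-GENʼs
generation binder at `σ₀` has `β(F) ≤ |𝒮| + 2`. [folklore] -/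
theorem card_block_le_card_add_two_of_hgen [IsCMField F] [IsGalois ℚ F] (D : ShearedDihedral.Datum (GalT F) conjT n) (𝒮 : Finset (Face F))
    (σ₀ : F →+* ℂ)
    (hgen : ∀ f : Face F, lefChar f.corner (fun _ => ({σ₀} : Finset (F →+* ℂ))) ∈ AddSubgroup.closure
      {a : Asym F | ∃ g ∈ (𝒮 : Set (Face F)), ∃ σ : F →+* ℂ, a = lefChar g.corner (fun _ => ({σ} : Finset (F →+* ℂ)))}) :
    Fintype.card (Block (conjT : GalT F)) ≤ 𝒮.card + 2 := by
  have h := FaceTransfer.le_card_of_hgen_of_floor (fibreTwo (conjT : GalT F) conjT_mul_self)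
    (fun S₀ hS₀ hS => fibreTwo_le_card conjT conjT_mul_self D.hcen S₀ (Submodule.span ℤ (pairSet conjT)) le_rfl hS₀
      (fun y hy => hS (gfaceSet_subset_hodgeSpan conjT conjT_mul_self hy))) 𝒮 σ₀ hgen
  rw [D.card_block_eq_fibreTwo_add_two conjT_mul_self]
  exact Nat.add_le_add_right h 2

/-- The same in `φ₂` currency: `φ₂(F) ≤ |𝒮|` and `φ₂(F) + 2 = β(F)`. [folklore] -/
theorem fibreTwo_le_card_of_hgen [IsCMField F] [IsGalois ℚ F] (D : ShearedDihedral.Datum (GalT F) conjT n) (𝒮 : Finset (Face F))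
    (σ₀ : F →+* ℂ)
    (hgen : ∀ f : Face F, lefChar f.corner (fun _ => ({σ₀} : Finset (F →+* ℂ))) ∈ AddSubgroup.closure
      {a : Asym F | ∃ g ∈ (𝒮 : Set (Face F)), ∃ σ : F →+* ℂ, a = lefChar g.corner (fun _ => ({σ} : Finset (F →+* ℂ)))}) :
    fibreTwo (conjT : GalT F) conjT_mul_self ≤ 𝒮.card ∧ fibreTwo (conjT : GalT F) conjT_mul_self + 2 = Fintype.card (Block (conjT : GalT F)) := by
  have h := card_block_le_card_add_two_of_hgen D 𝒮 σ₀ hgen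
  have e := D.card_block_eq_fibreTwo_add_two conjT_mul_self
  exact ⟨by omega, e.symm⟩

/-- **Degree `16`, the Pauli group (`n = 2`): at least `20` generating faces.** [folklore] -/
theorem twenty_le_card_of_hgen [IsCMField F] [IsGalois ℚ F] (D : ShearedDihedral.Datum (GalT F) conjT 2) (𝒮 : Finset (Face F)) (σ₀ : F →+* ℂ)
    (hgen : ∀ f : Face F, lefChar f.corner (fun _ => ({σ₀} : Finset (F →+* ℂ))) ∈ AddSubgroup.closure
      {a : Asym F | ∃ g ∈ (𝒮 : Set (Face F)), ∃ σ : F →+* ℂ, a = lefChar g.corner (fun _ => ({σ} : Finset (F →+* ℂ)))}) :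
    20 ≤ 𝒮.card := by
  have h := card_block_le_card_add_two_of_hgen D 𝒮 σ₀ hgen
  rw [(ShearedDihedral.Datum.card_block_eq_twentyTwo D conjT_mul_self).1] at h
  omega

/-- **Degree `24`, `X₃ = ℤ/3 ⋊ D₄` with Klein kernel (`n = 3`): at least `192` generating faces.** [folklore] -/
theorem oneHundredNinetyTwo_le_card_of_hgen [IsCMField F] [IsGalois ℚ F] (D : ShearedDihedral.Datum (GalT F) conjT 3) (𝒮 : Finset (Face F))
    (σ₀ : F →+* ℂ)
    (hgen : ∀ f : Face F, lefChar f.corner (fun _ => ({σ₀} : Finset (F →+* ℂ))) ∈ AddSubgroup.closure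
      {a : Asym F | ∃ g ∈ (𝒮 : Set (Face F)), ∃ σ : F →+* ℂ, a = lefChar g.corner (fun _ => ({σ} : Finset (F →+* ℂ)))}) :
    192 ≤ 𝒮.card := by
  have h := card_block_le_card_add_two_of_hgen D 𝒮 σ₀ hgen
  rw [(ShearedDihedral.Datum.card_block_eq_oneHundredNinetyFour D conjT_mul_self).1] at h
  omega

/-- **Degree `32`, `(ℤ/8 × ℤ/2) ⋊ (−a+4b, b)` (`n = 4`): at least `2126` generating faces.** [folklore] -/
theorem le_card_of_hgen_2126 [IsCMField F] [IsGalois ℚ F] (D : ShearedDihedral.Datum (GalT F) conjT 4) (𝒮 : Finset (Face F)) (σ₀ : F →+* ℂ)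
    (hgen : ∀ f : Face F, lefChar f.corner (fun _ => ({σ₀} : Finset (F →+* ℂ))) ∈ AddSubgroup.closure
      {a : Asym F | ∃ g ∈ (𝒮 : Set (Face F)), ∃ σ : F →+* ℂ, a = lefChar g.corner (fun _ => ({σ} : Finset (F →+* ℂ)))}) :
    2126 ≤ 𝒮.card := by
  have h := card_block_le_card_add_two_of_hgen D 𝒮 σ₀ hgen
  rw [(ShearedDihedral.Datum.card_block_eq_2128 D conjT_mul_self).1] at h
  omega

/-! ## §2 The datum from the automorphism group -/

/-- **The sheared dihedral datum from an `Aut`-datum.**  Automorphisms `g₀` (order `2n`, `g₀ⁿ` inducing complex conjugation at `σ₀`), `s₀` (an involution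
commuting with `g₀`, not a power of `g₀`) and `x₀` (an involution with `x₀ g₀ x₀⁻¹ = g₀⁻¹`, `x₀ s₀ x₀⁻¹ = g₀ⁿ s₀`, `x₀ ≠ g₀ⁱ s₀ʲ`) in a field of degree
`8n` give a sheared dihedral datum on `GalT F` through `galTOfAut σ₀`. [folklore] -/
theorem exists_datum_of_aut [IsGalois ℚ F] (σ₀ : F →+* ℂ) (g₀ s₀ x₀ : F ≃ₐ[ℚ] F) (hord : orderOf g₀ = 2 * n)
    (hcσ : σ₀.comp ((g₀ ^ n : F ≃ₐ[ℚ] F) : F →+* F) = conjugate σ₀) (hs2 : s₀ * s₀ = 1) (hgs : g₀ * s₀ = s₀ * g₀)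
    (hs : s₀ ∉ Subgroup.zpowers g₀) (hx2 : x₀ * x₀ = 1) (hxg : x₀ * g₀ * x₀⁻¹ = g₀⁻¹) (hxs : x₀ * s₀ * x₀⁻¹ = g₀ ^ n * s₀)
    (hx : ∀ i j : ℕ, x₀ ≠ g₀ ^ i * s₀ ^ j) (hdeg : Module.finrank ℚ F = 8 * n) :
    Nonempty (ShearedDihedral.Datum (GalT F) conjT n) := by
  -- the multiplicative equivalence `Aut(F) ≃* GalT F` at `σ₀`
  set e : (F ≃ₐ[ℚ] F) ≃* GalT F := MulEquiv.mk' (galTOfAut σ₀) (galTOfAut_mul σ₀) with he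
  have he_apply : ∀ y, e y = galTOfAut σ₀ y := fun y => rfl
  have hmem : ∀ y : F ≃ₐ[ℚ] F, e y ∈ Subgroup.zpowers (e g₀) ↔ y ∈ Subgroup.zpowers g₀ := by
    intro y
    constructor
    · intro h
      obtain ⟨k, hk⟩ := Subgroup.mem_zpowers_iff.mp h
      rw [← map_zpow, e.apply_eq_iff_eq] at hk
      exact Subgroup.mem_zpowers_iff.mpr ⟨k, hk⟩
    · intro h
      obtain ⟨k, hk⟩ := Subgroup.mem_zpowers_iff.mp h
      exact Subgroup.mem_zpowers_iff.mpr ⟨k, by rw [← map_zpow, hk]⟩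
  have hord' : orderOf (e g₀) = 2 * n := by
    rw [← hord]; exact orderOf_injective e.toMonoidHom e.injective g₀
  have hcard : Nat.card (GalT F) = 8 * n := by rw [Nat.card_eq_fintype_card, FaceCensus.card_galT, hdeg]
  have hgn' : e g₀ ^ n = conjT := by
    rw [← map_pow, he_apply]
    exact galTOfAut_conjAut σ₀ hcσ
  have hs2' : e s₀ * e s₀ = 1 := by rw [← map_mul, hs2, map_one]
  have hgs' : e g₀ * e s₀ = e s₀ * e g₀ := by rw [← map_mul, hgs, map_mul]
  have hs' : e s₀ ∉ Subgroup.zpowers (e g₀) := fun h => hs ((hmem s₀).mp h)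
  have hx2' : e x₀ * e x₀ = 1 := by rw [← map_mul, hx2, map_one]
  have hxg' : e x₀ * e g₀ * (e x₀)⁻¹ = (e g₀)⁻¹ := by rw [← map_mul, ← map_inv, ← map_mul, hxg, map_inv]
  have hxs' : e x₀ * e s₀ * (e x₀)⁻¹ = e g₀ ^ n * e s₀ := by rw [← map_mul, ← map_inv, ← map_mul, hxs, map_mul, map_pow]
  have hx' : ∀ i j : ℕ, e x₀ ≠ e g₀ ^ i * e s₀ ^ j := by
    intro i j h
    apply hx i j
    rw [← map_pow, ← map_pow, ← map_mul, e.apply_eq_iff_eq] at h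
    exact h
  exact ⟨⟨e g₀, e s₀, e x₀, hgn', hord', hs2', hgs', hs', hx2', hxg', hxs', hx', hcard⟩⟩

end Field

end Summit.HodgeConjecture.CorCM.FaceShearedDihedral
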